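import Literature.NumberTheory.PAdicHodge.FontaineDpst
import Literature.NumberTheory.GaloisRepresentations.FramedGaloisRepInduce
import Literature.NumberTheory.GaloisRepresentations.PinnedDatumLabels
import HarnessLib

/-!
# De Rham-ness and labelled Hodge–Tate weights of an induced representation, for THE pinned
# Fontaine data (Patrikis 2019, Lemma 7.2.1 — two named schemata)

Topic `NumberTheory/PAdicHodge`.  Two NAMED FACTS (D-0014, `def X : Prop`, cited) about the
induction `Ind_{Γ_E}^{Γ_K} W` (`FramedGaloisRep.induce`, global, matrix form) of a framed `ℓ`-adic
representation `W` of a number field `E` along a finite extension `E/K` of number fields, relative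
to Fontaine's PINNED data of the summit `Langlands` (`fontainePstAdicCompletion v ℓ hv`), in the
vocabulary of the accepted `PinnedDatumLabels` (`PinnedLabel`, `labelledHodgeTateWeightsAtLabel`):

* `IsDeRhamFramedInduceSchema` — if `W` is de Rham at every place `w ∣ ℓ` of `E` then
  `Ind_{Γ_E}^{Γ_K} W` is de Rham at every place `v ∣ ℓ` of `K`.  Patrikis, Lemma 7.2.1 (local:
  "Let `L/K/ℚ_ℓ` be finite, and let `W` be a de Rham representation of `Γ_L`. Then `V = Ind_L^K W`
  is also de Rham, and `D_dR(V)` is the image under the forgetful functor `Fil_L → Fil_K` of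
  `D_dR(W)`"), globalised by Mackey's formula
  `(Ind_{Γ_E}^{Γ_K} W)|_{Γ_{K_v}} ≅ ⊕_{w ∣ v} Ind_{E_w}^{K_v}(W|_{Γ_{E_w}})` (Serre 1968 Ch. I §2.3 /
  the use made of the lemma on p. 64 of Patrikis, "Consider a non-split prime `w ∣ ℓ` of `L`, above
  a place `v` of `F` … `D_dR(ρ_λ|_{Γ_{F_v}})` is the image under the forgetful functor … of
  `D_dR(r_λ|_{Γ_{L_w}})`") and by the stability of de Rham representations under direct sums
  (Brinon–Conrad Thm. 5.2.1).  This is the CONVERSE direction, over an arbitrary base number field,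
  of the accepted sibling `isDeRhamFramed_of_isDeRhamFramed_induce` (`DeRhamInducedRepresentation`,
  base `ℚ`), whose `-- TODO(general form)` line asks for exactly this.
* `LabelledWeightsInduceSchema` — the labelled Hodge–Tate weights of `Ind_{Γ_E}^{Γ_K} W` at a label
  `(v, τ)` of `K` are the multiset sum of the labelled weights of `W` at the `[E : K]` labels
  `(w, σ)` of `E` above `(v, τ)` (same lemma: `D_dR(V)` is `D_dR(W)` with the `L`-structure
  forgotten, so `gr D_dR(V) ⊗_{K,τ} ℚ̄_ℓ = ⊕_{σ ∣ τ} gr D_dR(W) ⊗_{L,σ} ℚ̄_ℓ`; globally with Mackey as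
  above).  "Above" is said through the global embeddings of the accepted `PinnedLabel.emb`
  (`σ.emb ∘ (K → E) = τ.emb`); the `[E : K] = d` labels above `τ` are given as an `emb`-injective
  family `Fin d → labels of E`, which by rigidity (`PinnedLabel.place_eq`, `.eq_of_emb_eq`) and the
  count of extensions of `τ.emb` to the separable `E/K` is the set of ALL labels above `τ`.

Both are statements relating Fontaine's functor for the pinned data of DIFFERENT local fields
(`E_w` and `K_v`); like the accepted `DeRhamBaseChange` (now proved, `DeRhamBaseChangeProofs`) and
the accepted `LabelledWeightsRestrictSchema` / `LabelledWeightsTwistSchema`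
(`FontainePstLabelledWeightsSchemata`) they are theorems for Fontaine's construction and become
theorems-by-construction at step D2 of the Upgrade path of `FontaineDpst`.  Wanted by the crux
`stmt-Langlands-17000` (`NonParallelVoid.TwistedInductionParallel`, line `symmetrise-pd-split`,
stub 3 `stub_potentialAutomorphyOfInducedTwist`: hypothesis (3) of BLGGT Thm. C for the induced
twist `Ind_E^K(ρ|_E ⊗ χ)`).

## References

* [Patrikis2019] S. Patrikis, *Variations on a theorem of Tate*, Mem. Amer. Math. Soc. 258 (2019),
  no. 1238 (arXiv:1207.6724): §7.2 Lemma 7.2.1 (p. 38 of the arXiv text), and its use p. 64.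
* [BrinonConrad2009] O. Brinon, B. Conrad, *CMI Summer School notes on p-adic Hodge theory* (2009),
  Thm. 5.2.1, Prop. 6.3.8.
* [SerreAbelianLadic1968] J.-P. Serre, *Abelian ℓ-adic representations and elliptic curves* (1968),
  Ch. I §2.3 (decomposition groups and induced representations).

`lean search 'InduceSchema|isDeRhamFramed_induce|labelledHodgeTateWeights.*induce'` (2026-08-17): only
the sibling `DeRhamInducedRepresentation` (converse direction, base `ℚ`, characters).
-/

noncomputable section

open scoped NumberField
open NumberField IsDedekindDomain Field Filter
open Literature.NumberTheory.GaloisRepresentations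

namespace Literature.NumberTheory.PAdicHodge

/-- **An induced representation of a de Rham representation is de Rham, for THE pinned Fontaine
data** (Patrikis 2019, Lemma 7.2.1, with Mackey's formula and stability under direct sums): for
number fields `K ⊆ E` with `[E : K] = d`, a prime `ℓ` and a framed `W : Γ_E → GL_n(ℚ̄_ℓ)` which is
de Rham at every place `w ∣ ℓ` of `E` (pinned datum `fontainePstAdicCompletion w ℓ hw`), the induced
representation `Ind_{Γ_E}^{Γ_K} W` (`FramedGaloisRep.induce`) is de Rham at every place `v ∣ ℓ` of
`K`.  Local statement in print: "`V = Ind_L^K W` is also de Rham"; globalisation: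
`(Ind_{Γ_E}^{Γ_K} W)|_{Γ_{K_v}} ≅ ⊕_{w ∣ v} Ind_{E_w}^{K_v}(W|_{Γ_{E_w}})`.
-- TODO(general form): the equivalence (`V` de Rham iff `W` de Rham) and the crystalline clause
-- (`Ind_L^K W` crystalline iff `W` crystalline and `L/K` unramified) of the same lemma.
[cite: Patrikis2019, Lemma 7.2.1 (§7.2; arXiv:1207.6724 p. 38) and p. 64]
[cite: BrinonConrad2009, Thm. 5.2.1] [cite: SerreAbelianLadic1968, Ch. I §2.3] -/
def IsDeRhamFramedInduceSchema : Prop :=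
  ∀ (K E : Type) [Field K] [NumberField K] [Field E] [NumberField E] [Algebra K E] (d : ℕ)
    (hd : Module.finrank K E = d) (ℓ : ℕ) [Fact ℓ.Prime] (n : ℕ)
    (W : FramedGaloisRep E (PadicAlgCl ℓ) n),
    (∀ (w : HeightOneSpectrum (𝓞 E)) (hw : ((ℓ : ℕ) : 𝓞 E) ∈ w.asIdeal),
      (fontainePstAdicCompletion w ℓ hw).IsDeRhamFramed (W.toLocal w)) →
    ∀ (v : HeightOneSpectrum (𝓞 K)) (hv : ((ℓ : ℕ) : 𝓞 K) ∈ v.asIdeal),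
      (fontainePstAdicCompletion v ℓ hv).IsDeRhamFramed ((W.induce K hd).toLocal v)

/-- **Labelled Hodge–Tate weights of an induced representation, for THE pinned Fontaine data**
(Patrikis 2019, Lemma 7.2.1: "`D_dR(V)` is the image under the forgetful functor `Fil_L → Fil_K`
of `D_dR(W)`", read on `τ`-components; with Mackey's formula): for number fields `K ⊆ E` with
`[E : K] = d`, a prime `ℓ`, a framed `W : Γ_E → GL_n(ℚ̄_ℓ)` and a label `(v, τ)` of `K` above `ℓ`
(`PinnedLabel ℓ v hv`), there are `d` labels `(w_i, σ_i)` of `E` ABOVE `(v, τ)` — their global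
embeddings extend that of `τ`, `σ_i.emb ∘ (K → E) = τ.emb` — with pairwise distinct global
embeddings (hence, by rigidity of pinned labels and the count of `K`-embeddings `E → ℚ̄_ℓ`, ALL the
labels of `E` above `(v, τ)`), and the `τ`-labelled Hodge–Tate weights of `Ind_{Γ_E}^{Γ_K} W` at
`v` are the multiset sum of the `σ_i`-labelled weights of `W` at the `w_i`:
`HT_{(v,τ)}(Ind W) = Σ_i HT_{(w_i,σ_i)}(W)`.
-- TODO(general form): the identity of filtered modules `D_{dR,K_v}(Ind W) = ⊕_{w ∣ v} forget D_{dR,E_w}(W)`.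
[cite: Patrikis2019, Lemma 7.2.1 (§7.2; arXiv:1207.6724 p. 38) and p. 64]
[cite: SerreAbelianLadic1968, Ch. I §2.3] -/
def LabelledWeightsInduceSchema : Prop :=
  ∀ (K E : Type) [Field K] [NumberField K] [Field E] [NumberField E] [Algebra K E] (d : ℕ)
    (hd : Module.finrank K E = d) (ℓ : ℕ) [Fact ℓ.Prime] (n : ℕ)
    (W : FramedGaloisRep E (PadicAlgCl ℓ) n)
    (v : HeightOneSpectrum (𝓞 K)) (hv : ((ℓ : ℕ) : 𝓞 K) ∈ v.asIdeal) (τ : PinnedLabel ℓ v hv),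
    ∃ (w : Fin d → HeightOneSpectrum (𝓞 E)) (hw : ∀ i, ((ℓ : ℕ) : 𝓞 E) ∈ (w i).asIdeal)
      (σ : ∀ i, PinnedLabel ℓ (w i) (hw i)),
      (∀ i, (σ i).emb.comp (algebraMap K E) = τ.emb) ∧
      (Function.Injective fun i => (σ i).emb) ∧
      labelledHodgeTateWeightsAtLabel (W.induce K hd) v hv τ =
        ∑ i, labelledHodgeTateWeightsAtLabel W (w i) (hw i) (σ i)

end Literature.NumberTheory.PAdicHodge

end
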